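import Literature.AlgebraicGeometry.Motives.HodgeLieTimesCMCurve
import Literature.AlgebraicGeometry.HodgeTheory.RankOneCentreTimesCMCurveProductSpan
import Summits.HodgeConjecture.CorCM.MumfordTateRankCMCurveTimesThreefold
import Summits.HodgeConjecture.CorCM.MumfordTateRankRibetTypeOne
import Literature.AlgebraicGeometry.Motives.HodgeLieOfAbelianVarietyBiproduct
import HarnessLib

/-!
# `dim MT(H¹(A × E)) = dim MT(H¹A) + 1` for a CM elliptic curve `E` and `A` with imaginary quadratic `End⁰A = ℚ(√−d)`, unless
# `End⁰E ≅ End⁰A` and the multiplicities of `√−d` on `H^{1,0}(A)` are unbalanced (Moonen–Zarhin 1999 Lemma (3.6) / Prop. (3.8),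
# «`Hg(X × E) = Hg(X) × Hg(E)` or `End⁰(E) = k` embeds into the centre of `End⁰(X)`», for the Mumford–Tate rank)

COR-CM (cell `pub-hodgecm2`, seat `b27` gen 48, count-neutral Mumford–Tate-rank ladder; theorems only, no definition, no named fact;
UNCONDITIONAL — nothing here uses or asserts HC_CM).  The complex-abelian-variety reading of `Motives/HodgeLieTimesCMCurve`
(`𝔥(H₁ ⊕ H₂) = 𝔥(H₁) × 𝔥(H₂)` for a CM-elliptic-curve summand under non-resonance of the `Θ`-trace slopes), fed with the data of the
tree's `HodgeTheory/RankOneCentreTimesCMCurveInvariance` (cell `pub-hodge-ring2`: `quadraticEnd_skewCentre_data`,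
`traceSlopes_ne_of_forall_ne_sq_mul`, `trace_theta_mul_baseChange_pullback_eq`).  Here `t(X) := dim MT(H¹X) = dim Lie Hg(H¹X) + 1`.

SETTING.  `A` a complex abelian variety with `0 < dim A`, `dim_ℚ End⁰A = 2` and `φ : A → A`, `φ ∘ φ = −d` (`d > 0`), so `End⁰A = ℚ(√−d)` is an
imaginary quadratic field (type IV with `e₀ = 1`: Ribet type `(g−1,1)`, Weil type `(2,2)`, …; ANY multiplicities `(n_{i√d}, n_{−i√d})` on
`H^{1,0}(A)`); `E` an elliptic curve with complex multiplication `χ ∘ χ = −d′` (`End⁰E = ℚ(√−d′)`).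

* §1 **`finrank_hodgeLie_hodge_one_prod_cmCurve_eq_add`** — if the multiplicities are BALANCED (`n_{i√d} = n_{−i√d}`) OR `d ≠ q²d′` for
  every rational `q` (`ℚ(√−d′) ≇ ℚ(√−d)`), then `dim Lie Hg(H¹(A × E)) = dim Lie Hg(H¹A) + dim Lie Hg(H¹E)` («`Hg(A × E) = Hg(A) × Hg(E)`»);
  **`mtRank_hodge_one_eq_add_one_of_isIsogenous_prod_quadraticEnd_cmCurve`** — `t(X) = t(A) + 1` for every `X ∼ A × E` (`t(E) = 2`).
* §2 field form: **`mtRank_hodge_one_eq_add_one_of_isIsogenous_prod_of_isEmpty_ringHom`** — `E` of CM type with NO ring homomorphism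
  `End⁰E → End⁰A` («no embedding of `k` into the centre of `End⁰(X)`», Prop. (3.8)): `t(X) = t(A) + 1`;
  **`mtRank_hodge_one_eq_add_one_of_isIsogenous_prod_cmCurve_of_balanced`** — balanced multiplicities: `t(X) = t(A) + 1` for EVERY CM curve `E`.
* §3 the cells: **`mtRank_hodge_one_eq_eleven_of_isIsogenous_cmCurve_prod_isSimple_threefold_of_isEmpty_ringHom`** — `E` a CM elliptic curve,
  `T` a SIMPLE abelian THREEFOLD with `dim_ℚ End⁰T = 2` (type IV(1,1), `t(T) = 10`) and `End⁰E ↛ End⁰T`: **`t(E × T) = 11`** (the cell left at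
  `≤ 11` in `CorCM/MumfordTateRankCMCurveTimesThreefold`; the same-field case `ℚ(√−d′) ≅ End⁰T` — Moonen–Zarhin's exceptional shape (a) of
  Thm. 0.1 (4), `t = 10` — is not decided here); **`mtRank_hodge_one_of_isIsogenous_cmCurve_prod_ribetTypeOne_of_isEmpty_ringHom`** — Ribet type
  `(g−1,1)`: `t(E × A) = g² + 2`.

## References
* [MoonenZarhin1999LowDim] B. Moonen, Yu. G. Zarhin, *Hodge classes on abelian varieties of low dimension*, Math. Ann. 315 (1999), §3 (3.1),
  Lemma (3.6), Prop. (3.8), §2 (2.3), Thm. 0.1 (4) [corpus: paper:arxiv-math_9901113 pp. 1, 5–7]. [cite: MoonenZarhin1999LowDim, §3 Lemma (3.6) and Prop. (3.8)]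
* [Deligne1982HodgeCycles] P. Deligne, LNM 900 (1982), I §3 Prop. 3.4 and Prop. 3.6. [cite: Deligne1982HodgeCycles, I §3 Prop. 3.6]
* [Ribet1983] K. A. Ribet, Amer. J. Math. 105 (1983), Thm. 3. [cite: Ribet1983, Thm. 3]
-/

noncomputable section

open scoped TensorProduct
open CategoryTheory CategoryTheory.Limits Module

namespace Summit.HodgeConjecture.CorCM

open Literature.AlgebraicGeometry.Motives
open Literature.AlgebraicGeometry.Motives.AbelianVariety
open Literature.AlgebraicGeometry.Motives.HodgeStructure
open Literature.AlgebraicGeometry.HodgeTheory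
open Literature.AlgebraicGeometry.ComplexMultiplication
open Literature.AlgebraicGeometry.Milne1999 (IsOfCMType)

variable [HodgeTensorFacts.{0, 0}] {X A C : AbelianVariety ℂ} {n n₁ n₂ : ℕ}

/-! ## §1 The product theorem for `A × E` -/

/-- **`dim Lie Hg(H¹(A × E)) = dim Lie Hg(H¹A) + dim Lie Hg(H¹E)`** for `A` with `dim_ℚ End⁰A = 2`, `φ ∘ φ = −d` (`d > 0`, `0 < dim A`) and an
elliptic curve `E` with `χ ∘ χ = −d′` (`d′ > 0`), provided the multiplicities of `± i√d` on `H^{1,0}(A)` are balanced OR `d ≠ q² d′` for all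
rational `q`.  Moonen–Zarhin's «`Hg(X × E) = Hg(X) × Hg(E)` unless `End⁰(E) = k` embeds into the centre of `End⁰(X)`» for the Lie algebras: the
abstract `exists_linearEquiv_prod_and_finrank_hodgeLie_eq_add_of_cmCurve_summand` on the bicone `H¹(A × E) = fst^* H¹A ⊕ snd^* H¹E`, with
skew centre `ℚφ^*` (`quadraticEnd_skewCentre_data`) and non-resonance of the `Θ`-trace slopes (`traceSlopes_ne_of_forall_ne_sq_mul`; in the
balanced case `tr(Θ_A φ^*) = 0 ≠ tr((φ^*)²)·tr(Θ_E χ^*)`). [cite: MoonenZarhin1999LowDim, §3 Lemma (3.6) and Prop. (3.8)]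
[cite: Deligne1982HodgeCycles, I §3 Prop. 3.6] -/
theorem finrank_hodgeLie_hodge_one_prod_cmCurve_eq_add (hA : IsSmoothProjective n₁ A.X) (hC : IsSmoothProjective n₂ C.X)
    {m : ℕ} (hP : IsSmoothProjective m (A.prod C).X) (hA0 : 0 < A.dim) (hA2 : Module.finrank ℚ A.endAlgebra = 2)
    (φ : A ⟶ A) {d : ℕ} (hd : 0 < d) (hφ : φ ≫ φ = -(d • 𝟙 A)) (hC1 : C.dim = 1) (χ : C ⟶ C) {d' : ℕ} (hd' : 0 < d')
    (hχ : χ ≫ χ = -(d' • 𝟙 C))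
    (hres : eigenMultiplicity A φ (Complex.I * (Real.sqrt d : ℂ)) = eigenMultiplicity A φ (-(Complex.I * (Real.sqrt d : ℂ))) ∨
      ∀ q : ℚ, (d : ℚ) ≠ q ^ 2 * d') :
    haveI := BettiUniverse.finite hP 1
    haveI := BettiUniverse.finite hA 1
    haveI := BettiUniverse.finite hC 1
    Module.finrank ℚ (BettiUniverse.hodge exists_isReal_hodgeModel_holds hP 1).hodgeLie =
      Module.finrank ℚ (BettiUniverse.hodge exists_isReal_hodgeModel_holds hA 1).hodgeLie +
        Module.finrank ℚ (BettiUniverse.hodge exists_isReal_hodgeModel_holds hC 1).hodgeLie := by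
  classical
  have hnA : A.dim = n₁ := schemeDim_eq_holds hA
  have hnC : C.dim = n₂ := schemeDim_eq_holds hC
  subst hnA hnC
  haveI := BettiUniverse.finite hP 1
  haveI := BettiUniverse.finite hA 1
  haveI := BettiUniverse.finite hC 1
  -- the bicone of `H¹`
  let ι₁ := BettiUniverse.pullHodgeHom exists_isReal_hodgeModel_holds hodgePQ_independent_of_hodgeModel_holds hP hA
    (fst A C).hom.hom.hom 1
  let π₁ := BettiUniverse.pullHodgeHom exists_isReal_hodgeModel_holds hodgePQ_independent_of_hodgeModel_holds hA hP
    (prodLift (𝟙 A) (0 : A ⟶ C)).hom.hom.hom 1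
  let ι₂ := BettiUniverse.pullHodgeHom exists_isReal_hodgeModel_holds hodgePQ_independent_of_hodgeModel_holds hP hC
    (snd A C).hom.hom.hom 1
  let π₂ := BettiUniverse.pullHodgeHom exists_isReal_hodgeModel_holds hodgePQ_independent_of_hodgeModel_holds hC hP
    (prodLift (0 : C ⟶ A) (𝟙 C)).hom.hom.hom 1
  have hsumP : fst A C ≫ prodLift (𝟙 A) (0 : A ⟶ C) + snd A C ≫ prodLift (0 : C ⟶ A) (𝟙 C) = 𝟙 _ := by
    refine prod_hom_ext ?_ ?_
    · rw [Preadditive.add_comp, Category.assoc, Category.assoc, prodLift_fst, prodLift_fst, Category.comp_id,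
        comp_zero, add_zero, Category.id_comp]
    · rw [Preadditive.add_comp, Category.assoc, Category.assoc, prodLift_snd, prodLift_snd, Category.comp_id,
        comp_zero, zero_add, Category.id_comp]
  have hπι₁ : ∀ v, π₁.toLinearMap (ι₁.toLinearMap v) = v := fun v => pull_pull_eq_self_of_comp_eq_id (prodLift_fst _ _) v
  have hπι₂ : ∀ v, π₂.toLinearMap (ι₂.toLinearMap v) = v := fun v => pull_pull_eq_self_of_comp_eq_id (prodLift_snd _ _) v
  have hsum : ∀ v, ι₁.toLinearMap (π₁.toLinearMap v) + ι₂.toLinearMap (π₂.toLinearMap v) = v := fun v =>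
    pull_pull_add_pull_pull_eq_self _ _ _ _ hsumP v
  -- polarizations, Hodge operators
  obtain ⟨ψ⟩ := BettiUniverse.hodge_isPolarizable exists_isReal_hodgeModel_holds hP 1
  obtain ⟨ψ₁⟩ := BettiUniverse.hodge_isPolarizable exists_isReal_hodgeModel_holds hA 1
  obtain ⟨ψ₂⟩ := BettiUniverse.hodge_isPolarizable exists_isReal_hodgeModel_holds hC 1
  obtain ⟨Θ₁, hΘ₁⟩ := exists_hodgeTheta (BettiUniverse.hodge exists_isReal_hodgeModel_holds hA 1)
  obtain ⟨Θ₂, hΘ₂⟩ := exists_hodgeTheta (BettiUniverse.hodge exists_isReal_hodgeModel_holds hC 1)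
  -- the data on `A`: `φ^*` and the skew centre `ℚφ^*`
  obtain ⟨hφE, hφ2, hZ⟩ := quadraticEnd_skewCentre_data exists_isReal_hodgeModel_holds hodgePQ_independent_of_hodgeModel_holds hA0 hA2
    hd hφ ψ₁
  -- the data on `E`: `χ^*`, `(χ^*)² = -d'`, `dim H¹(E) = 2`
  have hχE := pullback_mem_endAlg exists_isReal_hodgeModel_holds hodgePQ_independent_of_hodgeModel_holds χ
  have hχ2 : (bettiCohomology.map χ.hom.hom.hom 1).hom * (bettiCohomology.map χ.hom.hom.hom 1).hom = -((d' : ℚ) • 1) :=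
    bettiMapHom_mul_self hχ
  have hd'Q : (0 : ℚ) < d' := Nat.cast_pos.2 hd'
  have hV₂ : Module.finrank ℚ (bettiCohomology C.X 1) = 2 := by rw [finrank_bettiCohomology_one C, hC1]
  have heff₂ := BettiUniverse.hodge_isEffective exists_isReal_hodgeModel_holds hC 1
  -- non-resonance of the `Θ`-trace slopes
  have hres' : ∀ c : ℚ, ((LinearMap.trace ℚ _ ((bettiCohomology.map φ.hom.hom.hom 1).hom *
        (bettiCohomology.map φ.hom.hom.hom 1).hom) : ℚ) : ℂ) *
        LinearMap.trace ℂ _ (Θ₂ * (bettiCohomology.map χ.hom.hom.hom 1).hom.baseChange ℂ) ≠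
      (c : ℂ) * (LinearMap.trace ℂ _ (Θ₁ * (bettiCohomology.map φ.hom.hom.hom 1).hom.baseChange ℂ) *
        ((LinearMap.trace ℚ _ ((bettiCohomology.map χ.hom.hom.hom 1).hom *
          (bettiCohomology.map χ.hom.hom.hom 1).hom) : ℚ) : ℂ)) := by
    rcases hres with hbal | hfree
    · intro c hc
      rw [trace_theta_mul_baseChange_pullback_eq exists_isReal_hodgeModel_holds hodgePQ_independent_of_hodgeModel_holds φ hd hφ hΘ₁,
        trace_theta_mul_baseChange_pullback_eq exists_isReal_hodgeModel_holds hodgePQ_independent_of_hodgeModel_holds χ hd' hχ hΘ₂,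
        trace_pullback_mul_self_eq φ hφ, hbal, sub_self, mul_zero, zero_mul, mul_zero] at hc
      -- the left-hand side is non-zero
      have hsumC := eigenMultiplicity_add_eigenMultiplicity_neg_eq_dim C χ hd' hχ
      rw [hC1] at hsumC
      have hs : ((eigenMultiplicity C χ (Complex.I * (Real.sqrt d' : ℂ)) : ℂ) -
          (eigenMultiplicity C χ (-(Complex.I * (Real.sqrt d' : ℂ))) : ℂ)) ≠ 0 := by
        rcases Nat.eq_zero_or_pos (eigenMultiplicity C χ (Complex.I * (Real.sqrt d' : ℂ))) with h0 | h0
        · have h1 : eigenMultiplicity C χ (-(Complex.I * (Real.sqrt d' : ℂ))) = 1 := by omega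
          rw [h0, h1]; norm_num
        · have h1 : eigenMultiplicity C χ (Complex.I * (Real.sqrt d' : ℂ)) = 1 := by omega
          have h2 : eigenMultiplicity C χ (-(Complex.I * (Real.sqrt d' : ℂ))) = 0 := by omega
          rw [h1, h2]; norm_num
      have hsd' : (Real.sqrt d' : ℂ) ≠ 0 := by
        rw [Ne, Complex.ofReal_eq_zero]
        exact (Real.sqrt_pos.2 (Nat.cast_pos.2 hd')).ne'
      have hdA : (((-((d : ℚ) * (2 * ((A.dim : ℕ) : ℚ)))) : ℚ) : ℂ) ≠ 0 := by
        have h : (-((d : ℚ) * (2 * ((A.dim : ℕ) : ℚ)))) ≠ 0 := by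
          have hdQ : (d : ℚ) ≠ 0 := by exact_mod_cast hd.ne'
          have hdim : ((A.dim : ℕ) : ℚ) ≠ 0 := by exact_mod_cast hA0.ne'
          exact neg_ne_zero.2 (mul_ne_zero hdQ (mul_ne_zero two_ne_zero hdim))
        exact_mod_cast h
      exact (mul_ne_zero hdA (mul_ne_zero (mul_ne_zero two_ne_zero (mul_ne_zero Complex.I_ne_zero hsd')) hs)) hc
    · exact traceSlopes_ne_of_forall_ne_sq_mul exists_isReal_hodgeModel_holds hodgePQ_independent_of_hodgeModel_holds hA0 hd hφ hC1
        hd' hχ hfree hΘ₁ hΘ₂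
  exact (exists_linearEquiv_prod_and_finrank_hodgeLie_eq_add_of_cmCurve_summand ι₁ π₁ ι₂ π₂ hπι₁ hπι₂ hsum Nat.cast_one heff₂ ψ ψ₁ ψ₂
    hφE hZ hχE hd'Q hχ2 hV₂ hΘ₁ hΘ₂ hres').2

/-- An elliptic curve with `χ ∘ χ = −d′`, `d′ > 0`, is of CM type and has `t(E) = dim MT(H¹E) = 2`.
[cite: MoonenZarhin1999LowDim, §2 (2.1)] -/
theorem isOfCMType_and_mtRank_eq_two_of_curve_of_comp_self_eq_neg (hC : IsSmoothProjective n₂ C.X) (hC1 : C.dim = 1) (χ : C ⟶ C)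
    {d' : ℕ} (hd' : 0 < d') (hχ : χ ≫ χ = -(d' • 𝟙 C)) :
    haveI := BettiUniverse.finite hC 1
    IsOfCMType C ∧ (BettiUniverse.hodge exists_isReal_hodgeModel_holds hC 1).mtRank = 2 := by
  have hnC : C.dim = n₂ := schemeDim_eq_holds hC
  subst hnC
  have hcm : IsOfCMType C := by
    set χ' : CategoryTheory.End C := χ with hχ'
    have h : χ' * χ' = -(d' • (1 : CategoryTheory.End C)) := hχ
    refine (Literature.NumberTheory.ComplexMultiplication.EllipticCurve.isOfCMType_iff_exists_mul_self_eq_neg hC1).2 ⟨χ', d', hd', ?_⟩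
    rw [h, nsmul_eq_mul, mul_one]
  exact ⟨hcm, mtRank_hodge_one_eq_two_of_cm_curve hC1 hcm⟩

/-- **`t(X) = t(A) + 1` for `X ∼ A × E`**, `A` with `dim_ℚ End⁰A = 2`, `φ ∘ φ = −d`, `E` an elliptic curve with `χ ∘ χ = −d′`, under «balanced
multiplicities or `d ≠ q²d′`» (`t(A × E) + 1 = t(A) + t(E)` with `t(E) = 2`). [cite: MoonenZarhin1999LowDim, §3 Lemma (3.6) and Prop. (3.8)] -/
theorem mtRank_hodge_one_eq_add_one_of_isIsogenous_prod_quadraticEnd_cmCurve (hX : IsSmoothProjective n X.X)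
    (hA : IsSmoothProjective n₁ A.X) (hA0 : 0 < A.dim) (hA2 : Module.finrank ℚ A.endAlgebra = 2) (φ : A ⟶ A) {d : ℕ} (hd : 0 < d)
    (hφ : φ ≫ φ = -(d • 𝟙 A)) (hC1 : C.dim = 1) (χ : C ⟶ C) {d' : ℕ} (hd' : 0 < d') (hχ : χ ≫ χ = -(d' • 𝟙 C))
    (hres : eigenMultiplicity A φ (Complex.I * (Real.sqrt d : ℂ)) = eigenMultiplicity A φ (-(Complex.I * (Real.sqrt d : ℂ))) ∨
      ∀ q : ℚ, (d : ℚ) ≠ q ^ 2 * d')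
    (hXP : IsIsogenous X (A.prod C)) :
    haveI := BettiUniverse.finite hX 1
    haveI := BettiUniverse.finite hA 1
    (BettiUniverse.hodge exists_isReal_hodgeModel_holds hX 1).mtRank = (BettiUniverse.hodge exists_isReal_hodgeModel_holds hA 1).mtRank + 1 := by
  have hC : IsSmoothProjective C.dim C.X := AbelianVariety.isSmoothProjective_holds
  have hP : IsSmoothProjective (A.prod C).dim (A.prod C).X := AbelianVariety.isSmoothProjective_holds
  haveI := BettiUniverse.finite hX 1
  haveI := BettiUniverse.finite hA 1
  haveI := BettiUniverse.finite hC 1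
  haveI := BettiUniverse.finite hP 1
  have h0 : 0 < X.dim := by
    obtain ⟨f, hf⟩ := hXP
    rw [dim_eq_of_isIsogeny hf, dim_prod]; omega
  have h := finrank_hodgeLie_hodge_one_prod_cmCurve_eq_add hA hC hP hA0 hA2 φ hd hφ hC1 χ hd' hχ hres
  obtain ⟨-, h2⟩ := isOfCMType_and_mtRank_eq_two_of_curve_of_comp_self_eq_neg hC hC1 χ hd' hχ
  rw [← finrank_hodgeLie_hodge_one_eq_of_isIsogenous hX hP hXP] at h
  rw [mtRank_hodge_one_eq_finrank_hodgeLie_add_one hC (by omega)] at h2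
  rw [mtRank_hodge_one_eq_finrank_hodgeLie_add_one hX h0, mtRank_hodge_one_eq_finrank_hodgeLie_add_one hA hA0]
  omega

/-! ## §2 Field form and balanced form -/

/-- **Moonen–Zarhin Prop. (3.8) for the Mumford–Tate rank, imaginary quadratic `End⁰A`.**  Let `A` have `0 < dim A`, `dim_ℚ End⁰A = 2` and
`φ ∘ φ = −d` (`d > 0`), and let `E` be an elliptic curve of CM type such that there is NO ring homomorphism `End⁰E → End⁰A` (the CM field
`k = End⁰E` does not embed into the centre `End⁰A = ℚ(√−d)`).  Then `t(X) = t(A) + 1` for every `X ∼ A × E` («`Hg(X × E) = Hg(X) × Hg(E)`»).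
[cite: MoonenZarhin1999LowDim, §3 Prop. (3.8)] -/
theorem mtRank_hodge_one_eq_add_one_of_isIsogenous_prod_of_isEmpty_ringHom (hX : IsSmoothProjective n X.X)
    (hA : IsSmoothProjective n₁ A.X) (hA0 : 0 < A.dim) (hA2 : Module.finrank ℚ A.endAlgebra = 2) (φ : A ⟶ A) {d : ℕ} (hd : 0 < d)
    (hφ : φ ≫ φ = -(d • 𝟙 A)) (hC1 : C.dim = 1) (hCcm : IsOfCMType C) (hfor : IsEmpty (C.endAlgebra →+* A.endAlgebra))
    (hXP : IsIsogenous X (A.prod C)) :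
    haveI := BettiUniverse.finite hX 1
    haveI := BettiUniverse.finite hA 1
    (BettiUniverse.hodge exists_isReal_hodgeModel_holds hX 1).mtRank = (BettiUniverse.hodge exists_isReal_hodgeModel_holds hA 1).mtRank + 1 := by
  obtain ⟨χ, d', hd', hχ⟩ := exists_hom_comp_self_eq_neg_of_cmCurve hC1 hCcm
  exact mtRank_hodge_one_eq_add_one_of_isIsogenous_prod_quadraticEnd_cmCurve hX hA hA0 hA2 φ hd hφ hC1 χ hd' hχ
    (Or.inr (forall_ne_sq_mul_of_isEmpty_ringHom hfor (finrank_endAlgebra_eq_two_of_cmCurve hC1 hCcm) hd' hχ hφ hd)) hXP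

/-- **Balanced multiplicities: `t(X) = t(A) + 1` for `X ∼ A × E` and EVERY elliptic curve `E` of CM type** — `A` with `0 < dim A`,
`dim_ℚ End⁰A = 2`, `φ ∘ φ = −d` acting on `H^{1,0}(A)` with `n_{i√d} = n_{−i√d}` (e.g. a fourfold of Weil type `(2,2)`): the `Θ`-trace of `φ^*`
vanishes, so no resonance is possible even when `End⁰E ≅ End⁰A` (the centre of `Hg(A)` is then finite, `Hg(A) ⊆ SU`).
[cite: MoonenZarhin1999LowDim, §3 Lemma (3.6)] [cite: MoonenZarhin1999LowDim, §2 (2.3)] -/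
theorem mtRank_hodge_one_eq_add_one_of_isIsogenous_prod_cmCurve_of_balanced (hX : IsSmoothProjective n X.X)
    (hA : IsSmoothProjective n₁ A.X) (hA0 : 0 < A.dim) (hA2 : Module.finrank ℚ A.endAlgebra = 2) (φ : A ⟶ A) {d : ℕ} (hd : 0 < d)
    (hφ : φ ≫ φ = -(d • 𝟙 A))
    (hbal : eigenMultiplicity A φ (Complex.I * (Real.sqrt d : ℂ)) = eigenMultiplicity A φ (-(Complex.I * (Real.sqrt d : ℂ))))
    (hC1 : C.dim = 1) (hCcm : IsOfCMType C) (hXP : IsIsogenous X (A.prod C)) :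
    haveI := BettiUniverse.finite hX 1
    haveI := BettiUniverse.finite hA 1
    (BettiUniverse.hodge exists_isReal_hodgeModel_holds hX 1).mtRank = (BettiUniverse.hodge exists_isReal_hodgeModel_holds hA 1).mtRank + 1 := by
  obtain ⟨χ, d', hd', hχ⟩ := exists_hom_comp_self_eq_neg_of_cmCurve hC1 hCcm
  exact mtRank_hodge_one_eq_add_one_of_isIsogenous_prod_quadraticEnd_cmCurve hX hA hA0 hA2 φ hd hφ hC1 χ hd' hχ (Or.inl hbal) hXP

/-! ## §3 The cells: CM curve × type-IV threefold with a different field, and Ribet type -/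

/-- **CM elliptic curve × SIMPLE abelian THREEFOLD with (imaginary) quadratic `End⁰T`, DIFFERENT fields: `t = 11`.**  For `E` of CM type,
`T` simple of dimension `3` with `dim_ℚ End⁰T = 2` (Moonen–Zarhin's type IV(1,1): `End⁰T = ℚ(√−d)`, multiplicities `(2,1)`, `t(T) = 10`) and no
ring homomorphism `End⁰E → End⁰T`: `dim MT(H¹(E × T)) = 11` (`= t(T) + t(E) − 1`; the cell left at `≤ 11` in
`CorCM/MumfordTateRankCMCurveTimesThreefold`).  When `End⁰E ≅ End⁰T` the pair is Moonen–Zarhin's exceptional shape (a) of Thm. 0.1 (4).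
[cite: MoonenZarhin1999LowDim, §3 Prop. (3.8) and §2 (2.3)] -/
theorem mtRank_hodge_one_eq_eleven_of_isIsogenous_cmCurve_prod_isSimple_threefold_of_isEmpty_ringHom (hX : IsSmoothProjective n X.X)
    {E T : AbelianVariety ℂ} (hE1 : E.dim = 1) (hEcm : IsOfCMType E) (hTs : T.IsSimple) (hT3 : T.dim = 3)
    (hTE : Module.finrank ℚ T.endAlgebra = 2) (hfor : IsEmpty (E.endAlgebra →+* T.endAlgebra)) (hXP : IsIsogenous X (E.prod T)) :
    haveI := BettiUniverse.finite hX 1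
    (BettiUniverse.hodge exists_isReal_hodgeModel_holds hX 1).mtRank = 11 := by
  classical
  have hT : IsSmoothProjective T.dim T.X := AbelianVariety.isSmoothProjective_holds
  haveI := BettiUniverse.finite hX 1
  haveI := BettiUniverse.finite hT 1
  have h0 : 0 < T.dim := by omega
  -- `End⁰T = ℚ(φ)`, `φ ∘ φ = −d`
  have hF : IsField T.endAlgebra := AbelianVariety.isField_endAlgebra_of_isSimple_of_finrank_eq_two hTs h0 hTE
  have hnR : ¬ NumberField.IsTotallyReal (EndField T hF) := fun hR => by
    have h := finrank_endAlgebra_dvd_dim_of_isField_of_isTotallyReal hF h0 hR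
    rw [hTE, hT3] at h
    omega
  obtain ⟨a, q, hq, ha⟩ := AbelianVariety.exists_mul_self_eq_neg_of_finrank_eq_two h0 hTE hF hnR
  obtain ⟨φ, d, hd, hφ⟩ := AbelianVariety.exists_hom_comp_self_eq_neg T hq ha
  have h10 : (BettiUniverse.hodge exists_isReal_hodgeModel_holds hT 1).mtRank = 10 :=
    (mtRank_hodge_one_of_isSimple_threefold_of_finrank_endAlgebra_eq_two hT hTs hT3 hTE).1
  have h := mtRank_hodge_one_eq_add_one_of_isIsogenous_prod_of_isEmpty_ringHom hX hT h0 hTE φ hd hφ hE1 hEcm hfor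
    (hXP.trans (isIsogenous_prod_comm E T))
  omega

/-- **CM elliptic curve × Ribet type `(g − 1, 1)`, different fields: `t = g² + 2`.**  `A` of dimension `g ≥ 3` with `End⁰A` a field of
`ℚ`-dimension `2` that is not totally real, `φ ∘ φ = −d` with multiplicity one at `i√d` or at `−i√d` on `H^{1,0}(A)` (`t(A) = g² + 1`,
`CorCM/MumfordTateRankRibetTypeOne`), `E` of CM type with no ring homomorphism `End⁰E → End⁰A`: `dim MT(H¹(E × A)) = g² + 2`
(`Hg = U(1) × U(g−1,1)`). [cite: MoonenZarhin1999LowDim, §3 Prop. (3.8)] [cite: Ribet1983, Thm. 3] -/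
theorem mtRank_hodge_one_of_isIsogenous_cmCurve_prod_ribetTypeOne_of_isEmpty_ringHom (hX : IsSmoothProjective n X.X)
    {E : AbelianVariety ℂ} (hE1 : E.dim = 1) (hEcm : IsOfCMType E) (hF : IsField A.endAlgebra)
    (hnR : ¬ NumberField.IsTotallyReal (EndField A hF)) (φ : A ⟶ A) {d : ℕ}
    (hd : 0 < d) (hφ : φ ≫ φ = -(d • 𝟙 A)) (hA2 : Module.finrank ℚ A.endAlgebra = 2)
    (h1 : eigenMultiplicity A φ (Complex.I * (Real.sqrt d : ℂ)) = 1 ∨ eigenMultiplicity A φ (-(Complex.I * (Real.sqrt d : ℂ))) = 1)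
    (hdim : 3 ≤ A.dim) (hfor : IsEmpty (E.endAlgebra →+* A.endAlgebra)) (hXP : IsIsogenous X (E.prod A)) :
    haveI := BettiUniverse.finite hX 1
    (BettiUniverse.hodge exists_isReal_hodgeModel_holds hX 1).mtRank = A.dim * A.dim + 2 := by
  have hA : IsSmoothProjective A.dim A.X := AbelianVariety.isSmoothProjective_holds
  haveI := BettiUniverse.finite hX 1
  haveI := BettiUniverse.finite hA 1
  have hgg := (mtRank_hodge_one_of_ribetTypeOne' hA hF hnR φ hd hφ hA2 h1 hdim).1
  have h := mtRank_hodge_one_eq_add_one_of_isIsogenous_prod_of_isEmpty_ringHom hX hA (by omega) hA2 φ hd hφ hE1 hEcm hfor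
    (hXP.trans (isIsogenous_prod_comm E A))
  omega

end Summit.HodgeConjecture.CorCM

end
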